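import Literature.AlgebraicGeometry.HodgeTheory.AbelianVarietyCyclotomicAutomorphismProductTypes
import Literature.AlgebraicGeometry.HodgeTheory.WeilClassesFieldIntersections
import Literature.AlgebraicGeometry.HodgeTheory.LefschetzOneOneHolds
import Literature.AlgebraicGeometry.HodgeTheory.AlgebraicClassesHodgeTypeHolds
import HarnessLib

/-!
# Weil classes of degree `2` are algebraic as soon as they are Hodge (Lefschetz `(1,1)`): for `[F : ℚ] = dim X`,
# `W_F ⊗ ℂ ⊆ N¹H²` ⟺ `n_σ = n_σ̄` for all `σ`; for a product `A₁ × A₂` of two CM-level cyclotomic factors,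
# `W_{ℚ(ζ_m)}(A₁ × A₂) ⊗ ℂ` IS ALGEBRAIC ⟺ the CM types are complex conjugate, and `W(A × A, δ × δ⁻¹)` always is

Family `hodge`, lane `lit-hodgefound` (seat p03, GEN 36 «Hodge classes from the analytic type of a cyclotomic
automorphism»), topic `Literature/AlgebraicGeometry/HodgeTheory`.  Theorems only: no definition, no instance, no named
fact (net Literature debt 0).  Junction BY NAME of the tree's DISCHARGED Lefschetz theorem on `(1,1)`-classes
(`lefschetzOneOne_rational_holds`, Voisin I Thm. 11.30), the Hodge type of algebraic classes
(`isOfHodgeType_of_mem_algebraicClasses_of_isSmoothProjective`), the rational span of `W_F ⊗ ℂ`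
(`weilClassesField_le_hodgeClassSpan_iff`, `weilClassesField_inf_hodgeClassSpan_eq_bot_or_le`), Moonen–Zarhin's Criterion
(`Deligne1982.weilClassesField_le_hodgeClassSpan_iff_forall_eigenMultiplicity_eq`) and GEN 36's product file
`…CyclotomicAutomorphismProductTypes` (conjugate CM types ⟺ the degree-`2` Weil classes of `A₁ × A₂` are Hodge).

Moonen–Zarhin's space of Weil classes `W_F ⊂ H^r(X, ℚ)` has `r = 2 dim X/[F : ℚ]`; in the first case `r = 2` —
`[F : ℚ] = dim X`, e.g. `F = ℚ(ζ_m)` acting on a product of two abelian varieties of CM level `φ(m) = 2 dim Aᵢ`, or on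
one abelian variety with `φ(m) = dim A` — the Weil classes are classes of degree `2`, and the Hodge conjecture for them
is the Lefschetz theorem: they are algebraic iff they are Hodge iff (Criterion) `n_σ = n_σ̄` for all `σ`.  The
content of this file is that bookkeeping, stated on the tree's carriers (`weilClassesField`, `algebraicClasses X 1 =
N¹H²`, `hodgeClassSpan`, `eigenMultiplicity`, `cmTypeOf`).

## Sources, verbatim (held texts)

B. Moonen, Yu. Zarhin, *Weil classes on abelian varieties* (1998), held `paper:arxiv-alg-geom_9612017`, §1 (chunk p0001
L70–L84): «Let `W_F ⊂ H^r(X, ℚ)` […] `r = 2g/[F : ℚ]` […] Criterion: `W_F` consists of Hodge classes if and only if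
`n_σ = n_σ̄` for all `σ`»; (chunk p0001 L60–L67): «either `W_F` consists entirely of Hodge classes, or `0 ∈ W_F` is the
only Hodge class»; Introduction (chunk p0001 L18–L22): «The Hodge conjecture […] is known only in degree `2`
(Lefschetz) […]».

C. Voisin, *Hodge Theory and Complex Algebraic Geometry I* (2002) [VoisinHodgeI2002], §11.3 Thm. 11.30 (the Lefschetz
theorem on `(1,1)`-classes: every integral/rational class of type `(1,1)` is the class of a divisor) — the tree's theorem
`lefschetzOneOne_rational_holds`.

G. Shimura, *Abelian Varieties with Complex Multiplication and Modular Functions* (1998), §8.2 (chunk p0081 L1–L3): «any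
two abelian varieties of the same CM-type are isogenous to each other».

## What is proved (namespace `Literature.AlgebraicGeometry.HodgeTheory.AbelianVariety`)

* §1 (any `(A, φ)`, `P` irreducible, `P(φ) = 0`) **`weilClassesField_two_le_algebraicClasses_iff_forall_isOfHodgeType`**
  (`W_F ⊗ ℂ ⊆ N¹H² ⟺` every class of `W_F ⊗ ℂ ⊂ H²` is of type `(1,1)`), and for `[F : ℚ] = dim A`
  **`weilClassesField_two_le_algebraicClasses_iff_forall_eigenMultiplicity_eq`** (`⟺ n_ρ = n_ρ̄` for every root `ρ`);
  the cyclotomic reading `weilClassesField_cyclotomic_two_le_algebraicClasses_iff` (`φ(m) = dim A`: `⟺ n_ζ = n_{ζ⁻¹}` on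
  `μ_m^×`).
* §2 (two CM-level cyclotomic factors) **`weilClassesField_prodLift_le_algebraicClasses_iff_cmTypeOf_eq`**
  (`W_{ℚ(ζ_m)}(A₁ × A₂) ⊗ ℂ ⊆ N¹H²(A₁ × A₂) ⟺ Φ(δ₂) = Φ(δ₁⁻¹)`), `…_iff_forall_mem_iff_not_mem`,
  **`weilClassesField_prodLift_pow_pred_le_algebraicClasses`** (`W(A × A, δ × δ^{m−1})` IS ALGEBRAIC, unconditionally),
  `isIsogenous_of_weilClassesField_prodLift_le_algebraicClasses` (algebraic Weil classes force `A₂ ∼ A₁`), and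
  **`weilClassesField_prodLift_inf_hodgeClassSpan_eq_bot_of_hom_eq_zero`** (`Hom(A₂, A₁) = 0`:
  `W ⊗ ℂ ∩ B¹ ⊗ ℂ = 0`).

## References

* [MoonenZarhin1998WeilClasses] B. Moonen, Yu. Zarhin, J. reine angew. Math. 496 (1998), Introduction and §1 (chunk p0001).
* [VoisinHodgeI2002] C. Voisin, *Hodge Theory and Complex Algebraic Geometry I* (2002), §11.3 Thm. 11.30, Prop. 11.20.
* [Shimura1998] G. Shimura, *Abelian Varieties with Complex Multiplication and Modular Functions* (1998), §8.2 (chunk p0081).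
* [Deligne1982HodgeCycles] P. Deligne, *Hodge cycles on abelian varieties* (1982), §4 Prop. 4.4 (Criterion).
* [vanGeemen1994HodgeAV] B. van Geemen, LNM 1594 (1994), 2.1 (`B^p` and rational spans).
-/

noncomputable section

open CategoryTheory CategoryTheory.Limits Module Polynomial

namespace Literature.AlgebraicGeometry.HodgeTheory

namespace AbelianVariety

open Literature.AlgebraicTopology.SingularHomology
open Literature.AlgebraicGeometry.Motives (IsSmoothProjective)
open Literature.AlgebraicGeometry.VanGeemen1994 (hodgeClassSpan)
open Literature.AlgebraicGeometry.Motives.AbelianVariety (prodLift fst snd)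

/-! ## §1 Degree-`2` Weil classes: algebraic ⟺ Hodge ⟺ `n_σ = n_σ̄` -/

section DegreeTwo

variable {A : Motives.AbelianVariety ℂ} {φ : A ⟶ A} {P : ℤ[X]} {m : ℕ}

/-- `Φ_m ∈ ℤ[X]` is irreducible over `ℚ`. [folklore] -/
private theorem irreducible_cyclotomic_int_map_rat (hm : 0 < m) :
    Irreducible ((cyclotomic m ℤ).map (Int.castRingHom ℚ)) := by
  rw [map_cyclotomic]
  exact cyclotomic.irreducible_rat hm

/-- **Degree-`2` Weil classes are algebraic iff they are Hodge** (`P` irreducible over `ℚ`, `P(φ) = 0`):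
`W_F ⊗ ℂ ⊆ N¹H²(A) = algebraicClasses A.X 1` iff every class of `W_F ⊗ ℂ ⊂ H²` is of type `(1,1)` — «⟸» `W_F ⊗ ℂ` is
spanned by its rational classes (`weilClassesField_le_hodgeClassSpan_iff`) and rational `(1,1)`-classes are algebraic
(Lefschetz, `lefschetzOneOne_rational_holds`); «⟹» algebraic classes are of type `(p,p)`. «The Hodge conjecture […] is
known […] in degree `2` (Lefschetz)». [cite: MoonenZarhin1998WeilClasses, Introduction and §1 (chunk p0001 L18–L22, L70–L84)]
[cite: VoisinHodgeI2002, §11.3 Thm. 11.30 and §11.1.2 Prop. 11.20] -/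
theorem weilClassesField_two_le_algebraicClasses_iff_forall_isOfHodgeType
    (hPirr : Irreducible (P.map (Int.castRingHom ℚ)))
    (hφ : P.eval₂ (Int.castRingHom (End A)) (End.of φ) = 0) :
    weilClassesField A φ P 2 ≤ algebraicClasses A.X 1 ↔
      ∀ c ∈ weilClassesField A φ P 2, IsOfHodgeType A.dim A.X 2 1 1 c := by
  have hX : IsSmoothProjective A.dim A.X := Motives.AbelianVariety.isSmoothProjective_holds
  constructor
  · intro h c hc
    exact isOfHodgeType_of_mem_algebraicClasses_of_isSmoothProjective hX 1 (h hc)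
  · intro h
    have h1 : weilClassesField A φ P (2 * 1) ≤ hodgeClassSpan A.dim A.X 1 :=
      (weilClassesField_le_hodgeClassSpan_iff hPirr hφ).2 h
    exact h1.trans (Submodule.span_le.2 fun _ ⟨hcQ, hcH⟩ ↦ lefschetzOneOne_rational_holds hX _ hcQ hcH)

/-- **Moonen–Zarhin's Criterion in degree `2`, algebraic form**: for `P` monic irreducible of degree `dim A` (`[F : ℚ] =
dim A`, `r = 2`) with `P(φ) = 0`, `W_F ⊗ ℂ ⊆ N¹H²(A)` iff `n_ρ = n_ρ̄` for every complex root `ρ` of `P`.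
[cite: MoonenZarhin1998WeilClasses, §1 Criterion (chunk p0001 L80–L84)] [cite: Deligne1982HodgeCycles, §4 Prop. 4.4]
[cite: VoisinHodgeI2002, §11.3 Thm. 11.30] -/
theorem weilClassesField_two_le_algebraicClasses_iff_forall_eigenMultiplicity_eq (hPm : P.Monic)
    (hPirr : Irreducible (P.map (Int.castRingHom ℚ)))
    (hφ : P.eval₂ (Int.castRingHom (End A)) (End.of φ) = 0) (hdeg : P.natDegree = A.dim) :
    weilClassesField A φ P 2 ≤ algebraicClasses A.X 1 ↔
      ∀ ρ : ℂ, P.eval₂ (Int.castRingHom ℂ) ρ = 0 → eigenMultiplicity A φ ρ = eigenMultiplicity A φ (starRingEnd ℂ ρ) := by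
  rw [weilClassesField_two_le_algebraicClasses_iff_forall_isOfHodgeType hPirr hφ,
    ← weilClassesField_le_hodgeClassSpan_iff (m := 1) hPirr hφ]
  exact Deligne1982.weilClassesField_le_hodgeClassSpan_iff_forall_eigenMultiplicity_eq hPm rfl hPirr hφ (by omega)

/-- **Cyclotomic reading, `φ(m) = dim A` (`r = 2`)**: `W_{ℚ(ζ_m)}(A) ⊗ ℂ ⊆ N¹H²(A)` iff `n_ζ(δ) = n_{ζ⁻¹}(δ)` for every
primitive `m`-th root of unity `ζ`. [cite: MoonenZarhin1998WeilClasses, §1 Criterion (chunk p0001 L80–L84)]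
[cite: VoisinHodgeI2002, §11.3 Thm. 11.30] -/
theorem weilClassesField_cyclotomic_two_le_algebraicClasses_iff (hm : 0 < m) {δ : A ⟶ A}
    (hδ : (cyclotomic m ℤ).eval₂ (Int.castRingHom (End A)) (End.of δ) = 0) (hA : Nat.totient m = A.dim) :
    weilClassesField A δ (cyclotomic m ℤ) 2 ≤ algebraicClasses A.X 1 ↔
      ∀ ζ : ℂ, IsPrimitiveRoot ζ m → eigenMultiplicity A δ ζ = eigenMultiplicity A δ ζ⁻¹ := by
  rw [weilClassesField_two_le_algebraicClasses_iff_forall_isOfHodgeType (irreducible_cyclotomic_int_map_rat hm) hδ]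
  exact forall_isOfHodgeType_weilClassesField_cyclotomic_iff hm hδ (r := 2) (by rw [hA]; ring)

/-- **Degree-`2` Weil classes that are Hodge are algebraic** (the useful direction, no degree hypothesis).
[cite: VoisinHodgeI2002, §11.3 Thm. 11.30] [cite: MoonenZarhin1998WeilClasses, Introduction (chunk p0001 L18–L22)] -/
theorem mem_algebraicClasses_of_mem_weilClassesField_two (hPirr : Irreducible (P.map (Int.castRingHom ℚ)))
    (hφ : P.eval₂ (Int.castRingHom (End A)) (End.of φ) = 0)
    (h : ∀ c ∈ weilClassesField A φ P 2, IsOfHodgeType A.dim A.X 2 1 1 c) {c : complexBetti A.X 2}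
    (hc : c ∈ weilClassesField A φ P 2) : c ∈ algebraicClasses A.X 1 :=
  (weilClassesField_two_le_algebraicClasses_iff_forall_isOfHodgeType hPirr hφ).2 h hc

end DegreeTwo

/-! ## §2 Two CM-level cyclotomic factors: `W_{ℚ(ζ_m)}(A₁ × A₂)` is algebraic ⟺ conjugate CM types -/

section Products

variable {A₁ A₂ : Motives.AbelianVariety ℂ} {δ₁ : A₁ ⟶ A₁} {δ₂ : A₂ ⟶ A₂} {m : ℕ}

/-- **`W_{ℚ(ζ_m)}(A₁ × A₂) ⊗ ℂ ⊆ N¹H²(A₁ × A₂)` ⟺ `Φ(δ₂) = Φ(δ₁^{m−1})`** (both factors at the CM level `φ(m) = 2 dim Aᵢ`):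
the degree-`2` Weil classes of the product are ALGEBRAIC iff the CM types are complex conjugate (Lefschetz `(1,1)` on
top of `…ProductTypes`). [cite: MoonenZarhin1998WeilClasses, §1 Criterion (chunk p0001 L70–L84)] [cite: VoisinHodgeI2002, §11.3 Thm. 11.30]
[cite: Shimura1998, §5.2 (chunk p0051)] -/
theorem weilClassesField_prodLift_le_algebraicClasses_iff_cmTypeOf_eq [NeZero m]
    (hδ₁ : (cyclotomic m ℤ).eval₂ (Int.castRingHom (End A₁)) (End.of δ₁) = 0)
    (hδ₂ : (cyclotomic m ℤ).eval₂ (Int.castRingHom (End A₂)) (End.of δ₂) = 0)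
    (hg₁ : Nat.totient m = 2 * A₁.dim) (hg₂ : Nat.totient m = 2 * A₂.dim) :
    weilClassesField (A₁.prod A₂) (prodLift (fst A₁ A₂ ≫ δ₁) (snd A₁ A₂ ≫ δ₂)) (cyclotomic m ℤ) 2 ≤
        algebraicClasses (A₁.prod A₂).X 1 ↔
      cmTypeOf A₂ δ₂ m = cmTypeOf A₁ (End.asHom (End.of δ₁ ^ (m - 1))) m := by
  rw [weilClassesField_two_le_algebraicClasses_iff_forall_isOfHodgeType
    (irreducible_cyclotomic_int_map_rat (NeZero.pos m)) (eval₂_cyclotomic_prodLift_eq_zero hδ₁ hδ₂)]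
  exact forall_isOfHodgeType_weilClassesField_prodLift_iff_cmTypeOf_eq_cmTypeOf_pow_pred hδ₁ hδ₂ hg₁ hg₂

/-- **… ⟺ for every unit `t`, `t ∈ Φ(δ₂) ⟺ t ∉ Φ(δ₁)`.** [cite: MoonenZarhin1998WeilClasses, §1 Criterion (chunk p0001 L70–L84)]
[cite: VoisinHodgeI2002, §11.3 Thm. 11.30] -/
theorem weilClassesField_prodLift_le_algebraicClasses_iff_forall_mem_iff_not_mem (hm : 0 < m)
    (hδ₁ : (cyclotomic m ℤ).eval₂ (Int.castRingHom (End A₁)) (End.of δ₁) = 0)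
    (hδ₂ : (cyclotomic m ℤ).eval₂ (Int.castRingHom (End A₂)) (End.of δ₂) = 0)
    (hg₁ : Nat.totient m = 2 * A₁.dim) (hg₂ : Nat.totient m = 2 * A₂.dim) :
    weilClassesField (A₁.prod A₂) (prodLift (fst A₁ A₂ ≫ δ₁) (snd A₁ A₂ ≫ δ₂)) (cyclotomic m ℤ) 2 ≤
        algebraicClasses (A₁.prod A₂).X 1 ↔
      ∀ t : ZMod m, t.val.Coprime m → (t ∈ cmTypeOf A₂ δ₂ m ↔ t ∉ cmTypeOf A₁ δ₁ m) := by
  rw [weilClassesField_two_le_algebraicClasses_iff_forall_isOfHodgeType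
    (irreducible_cyclotomic_int_map_rat hm) (eval₂_cyclotomic_prodLift_eq_zero hδ₁ hδ₂)]
  exact forall_isOfHodgeType_weilClassesField_prodLift_iff_forall_mem_iff_not_mem hm hδ₁ hδ₂ hg₁ hg₂

/-- **`W_{ℚ(ζ_m)}(A × A, δ × δ^{m−1})` IS ALGEBRAIC**, unconditionally: on the square of a CM-level `(A, δ)` with
`ℚ(ζ_m)` acting by `δ` on the first factor and by `δ⁻¹ = δ^{m−1}` on the second, every Weil class (degree `2`) is a
`ℂ`-combination of divisor classes. [cite: MoonenZarhin1998WeilClasses, §1 Criterion (chunk p0001 L70–L84)]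
[cite: VoisinHodgeI2002, §11.3 Thm. 11.30] -/
theorem weilClassesField_prodLift_pow_pred_le_algebraicClasses [NeZero m] {A : Motives.AbelianVariety ℂ} {δ : A ⟶ A}
    (hδ : (cyclotomic m ℤ).eval₂ (Int.castRingHom (End A)) (End.of δ) = 0) (hg : Nat.totient m = 2 * A.dim) :
    weilClassesField (A.prod A) (prodLift (fst A A ≫ δ) (snd A A ≫ End.asHom (End.of δ ^ (m - 1))))
        (cyclotomic m ℤ) 2 ≤ algebraicClasses (A.prod A).X 1 :=
  (weilClassesField_prodLift_le_algebraicClasses_iff_cmTypeOf_eq hδ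
    (eval₂_cyclotomic_pow_pred_eq_zero (NeZero.pos m) hδ) hg hg).2 rfl

/-- **Algebraic degree-`2` Weil classes on `A₁ × A₂` force `A₂ ∼ A₁`** (conjugate types are types of `(A₁, δ₁⁻¹)` and
`(A₂, δ₂)`; Shimura's Corollary). [cite: Shimura1998, §8.2 (chunk p0081 L1–L3)] [cite: MoonenZarhin1998WeilClasses, §1–§2 (chunks p0001–p0002)] -/
theorem isIsogenous_of_weilClassesField_prodLift_le_algebraicClasses [NeZero m]
    (hδ₁ : (cyclotomic m ℤ).eval₂ (Int.castRingHom (End A₁)) (End.of δ₁) = 0)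
    (hδ₂ : (cyclotomic m ℤ).eval₂ (Int.castRingHom (End A₂)) (End.of δ₂) = 0)
    (hg₁ : Nat.totient m = 2 * A₁.dim) (hg₂ : Nat.totient m = 2 * A₂.dim)
    (h : weilClassesField (A₁.prod A₂) (prodLift (fst A₁ A₂ ≫ δ₁) (snd A₁ A₂ ≫ δ₂)) (cyclotomic m ℤ) 2 ≤
      algebraicClasses (A₁.prod A₂).X 1) : A₂.IsIsogenous A₁ :=
  isIsogenous_of_forall_isOfHodgeType_weilClassesField_prodLift hδ₁ hδ₂ hg₁ hg₂
    ((weilClassesField_two_le_algebraicClasses_iff_forall_isOfHodgeType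
      (irreducible_cyclotomic_int_map_rat (NeZero.pos m)) (eval₂_cyclotomic_prodLift_eq_zero hδ₁ hδ₂)).1 h)

/-- **`Hom(A₂, A₁) = 0` ⟹ the degree-`2` Weil classes of `A₁ × A₂` are NOT all algebraic.**
[cite: MoonenZarhin1998WeilClasses, §1–§2 (chunks p0001–p0002)] [cite: Shimura1998, §8.2 (chunk p0081 L1–L3)] -/
theorem not_weilClassesField_prodLift_le_algebraicClasses_of_hom_eq_zero [NeZero m]
    (hδ₁ : (cyclotomic m ℤ).eval₂ (Int.castRingHom (End A₁)) (End.of δ₁) = 0)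
    (hδ₂ : (cyclotomic m ℤ).eval₂ (Int.castRingHom (End A₂)) (End.of δ₂) = 0)
    (hg₁ : Nat.totient m = 2 * A₁.dim) (hg₂ : Nat.totient m = 2 * A₂.dim) (hBA : ∀ f : A₂ ⟶ A₁, f = 0) :
    ¬ weilClassesField (A₁.prod A₂) (prodLift (fst A₁ A₂ ≫ δ₁) (snd A₁ A₂ ≫ δ₂)) (cyclotomic m ℤ) 2 ≤
      algebraicClasses (A₁.prod A₂).X 1 := by
  rw [weilClassesField_two_le_algebraicClasses_iff_forall_isOfHodgeType
    (irreducible_cyclotomic_int_map_rat (NeZero.pos m)) (eval₂_cyclotomic_prodLift_eq_zero hδ₁ hδ₂)]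
  exact not_forall_isOfHodgeType_weilClassesField_prodLift_of_hom_eq_zero hδ₁ hδ₂ hg₁ hg₂ hBA

/-- **`Hom(A₂, A₁) = 0` ⟹ `W ⊗ ℂ ∩ B¹(A₁ × A₂) ⊗ ℂ = 0`**: the zero class is the only Hodge class among the degree-`2` Weil
classes, over `ℂ` («either `W_F` consists entirely of Hodge classes, or `0 ∈ W_F` is the only Hodge class»).
[cite: MoonenZarhin1998WeilClasses, §1 «all or nothing» (chunk p0001 L60–L67) and §2 (chunk p0002)] [cite: vanGeemen1994HodgeAV, 2.1] -/
theorem weilClassesField_prodLift_inf_hodgeClassSpan_eq_bot_of_hom_eq_zero [NeZero m]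
    (hδ₁ : (cyclotomic m ℤ).eval₂ (Int.castRingHom (End A₁)) (End.of δ₁) = 0)
    (hδ₂ : (cyclotomic m ℤ).eval₂ (Int.castRingHom (End A₂)) (End.of δ₂) = 0)
    (hg₁ : Nat.totient m = 2 * A₁.dim) (hg₂ : Nat.totient m = 2 * A₂.dim) (hBA : ∀ f : A₂ ⟶ A₁, f = 0) :
    weilClassesField (A₁.prod A₂) (prodLift (fst A₁ A₂ ≫ δ₁) (snd A₁ A₂ ≫ δ₂)) (cyclotomic m ℤ) 2 ⊓
      hodgeClassSpan (A₁.prod A₂).dim (A₁.prod A₂).X 1 = ⊥ := by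
  have hm : 0 < m := NeZero.pos m
  have hP := eval₂_cyclotomic_prodLift_eq_zero hδ₁ hδ₂
  have her : Nat.totient m * (2 * 1) = 2 * (A₁.prod A₂).dim := by
    rw [Motives.AbelianVariety.dim_prod, mul_add, ← hg₁, ← hg₂]; ring
  rcases weilClassesField_inf_hodgeClassSpan_eq_bot_or_le (natDegree_cyclotomic m ℤ)
    (irreducible_cyclotomic_int_map_rat hm) hP her one_ne_zero with h | h
  · exact h
  · exact absurd ((weilClassesField_le_hodgeClassSpan_iff (irreducible_cyclotomic_int_map_rat hm) hP).1 h)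
      (not_forall_isOfHodgeType_weilClassesField_prodLift_of_hom_eq_zero hδ₁ hδ₂ hg₁ hg₂ hBA)

end Products

end AbelianVariety

end Literature.AlgebraicGeometry.HodgeTheory

end
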